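import Summits.PneNP.PneNP.Theorems.PermanentDescentCollapseMakesPermanentEasyDefs
import Literature.Computability.Complexity.CodeFPArith
import Literature.Computability.Complexity.CodeFPStrings
import Literature.Computability.Complexity.CodeFPTableKit
import Literature.Computability.Complexity.CodeFPLists
import Literature.Computability.Complexity.CodeFPBudgets
import Literature.Computability.Complexity.SumcheckMAReferee

/-!
# Route PermanentDescent, crux `CollapseMakesPermanentEasy` (stmt-PneNP-16142), line `birth` v2 — `stub_checkFP`

Registered stub `stub_checkFP` of the skeleton `Cruxes/CollapseMakesPermanentEasy/Lines/birth.lean` (v2), over the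
objects of `Theorems/PermanentDescentCollapseMakesPermanentEasyDefs.lean` (namespace
`Summit.PneNP.PneNP.Theorems.PermCert`): the certificate matrix `((x, w), y) ↦ checkB χ x w y` is computed on
codes in polynomial time, given that the table value map `(W, 1ᴮ, s) ↦ valT χ W B s` is. The proof is pure
`CodeFP` plumbing (no machine is written): the table `decNil w` by `SumcheckMA.decNilC`, the budget
`|fstF x| + 1` and the side `√|y|` by `strLength`/`natSqrt`, the square tests by `natMul`/`natEq`/`natLe`;
the minor words `minorWord k j y` by a `map` over `urange (k²)` computing each letter position with
`natMod`/`natDiv`/`natLe` and reading the letter with `strGetDNat` (`minorWord_codeFP`); the Laplace sum by a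
`map` over `urange (k + 1)` of `ite (y[j]) (valT … (minorWord k j y)) 0` followed by `natSum`; `rhsT` by an
`ite` on `|y| = 0`; and finally the decided implication as `¬(A₁ ∧ A₂) ∨ E` on bits.
-/

set_option linter.dupNamespace false -- `Summit.PneNP.PneNP.…`: summit = sub-problem name (D-0017 single-conjunct layout)

namespace Summit.PneNP.PneNP.Theorems.PermCert

open _root_.Computability Polynomial
open Literature.Computability.Complexity Literature.Computability.Complexity.Brick
  Literature.Computability.Complexity.CodeFP

/-- A decided implication out of a conjunction, on bits: `[A ∧ B → C] = ¬([A] ∧ [B]) ∨ [C]`. [folklore] -/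
theorem not_and_or_eq_decide_imp (a b c : Prop) [Decidable a] [Decidable b] [Decidable c] :
    (!(decide a && decide b) || decide c) = decide (a ∧ b → c) := by
  by_cases ha : a <;> by_cases hb : b <;> by_cases hc : c <;> simp [ha, hb, hc]

/-- **The minor word is polynomial time on codes**: `(s, 1ᵏ, j) ↦ minorWord k j s` (a `map` over the
range `[0, k²)` of the letter positions `t % k + [j ≤ t % k] + (k + 1)(t / k + 1)`, each letter read by
`strGetDNat`). [cite: AroraBarak2009, §1.3 (closure of polynomial time under bounded loops)] -/
theorem minorWord_codeFP :
    CodeFP (pairE strE (pairE unE natE)) strE (fun p => minorWord p.2.1 p.2.2 p.1) := by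
  -- the letter of position `t` (context `q.1 = (s, 1ᵏ, j)`, item `q.2 = t`)
  let Q : (List Bool × ℕ × ℕ) × ℕ → List Bool := pairE (pairE strE (pairE unE natE)) natE
  have qs : CodeFP Q strE (fun q => q.1.1) := (fst _ _).fst'
  have qk : CodeFP Q natE (fun q => q.1.2.1) := (natOfUn.comp (fst _ _).snd'.fst' :)
  have qj : CodeFP Q natE (fun q => q.1.2.2) := (fst _ _).snd'.snd'
  have qt : CodeFP Q natE (fun q => q.2) := snd _ _
  have qm : CodeFP Q natE (fun q => q.2 % q.1.2.1) := natMod.comp (qt.pair qk)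
  have qi : CodeFP Q natE (fun q => if q.1.2.2 ≤ q.2 % q.1.2.1 then 1 else 0) :=
    ((natLe.comp (qj.pair qm)).ite (const _ 1) (const _ 0)).congr fun q => by
      simp only [decide_eq_true_eq]
  have qidx : CodeFP Q natE (fun q => q.2 % q.1.2.1 + (if q.1.2.2 ≤ q.2 % q.1.2.1 then 1 else 0) +
      (q.1.2.1 + 1) * (q.2 / q.1.2.1 + 1)) :=
    natAdd.comp ((natAdd.comp (qm.pair qi)).pair (natMul.comp
      ((natAdd.comp (qk.pair (const _ 1))).pair (natAdd.comp ((natDiv.comp (qt.pair qk)).pair (const _ 1))))))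
  have qbit : CodeFP Q bitE (fun q => q.1.1.getD (q.2 % q.1.2.1 + (if q.1.2.2 ≤ q.2 % q.1.2.1 then 1 else 0) +
      (q.1.2.1 + 1) * (q.2 / q.1.2.1 + 1)) false) :=
    strGetDNat.comp (qs.pair qidx)
  -- the range `[0, k²)` of positions, from the unary `k` through the unit budget `k²`
  have pkk : CodeFP (pairE strE (pairE unE natE)) unE (fun p => p.2.1 * p.2.1) :=
    ((ulength unitE).comp ((unitsPow 2).comp (snd _ _).fst')).congr fun p => by
      rw [List.length_replicate, pow_two]
  have prange : CodeFP (pairE strE (pairE unE natE)) (rawE natE) (fun p => List.range (p.2.1 * p.2.1)) :=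
    urange.comp pkk
  exact (bitsToStr.comp ((CodeFP.map qbit).comp ((CodeFP.id _).pair prange))).congr fun p => rfl

/-- **Stub FC (the certificate matrix is polynomial time; `CodeFP` plumbing).** Given the value map
`(W, 1ᴮ, s) ↦ valT χ W B s` on codes, the matrix `((x, w), y) ↦ checkB χ x w y` of the Laplace certificate
is computed on codes in polynomial time: the table `decNil w` (`decNilC`), the budget `|fstF x| + 1` and the
side `√|y|` (`strLength`, `natSqrt`), the square tests (`natMul`, `natEq`, `natLe`), the minors
(`minorWord_codeFP`), the Laplace sum (`map`, `natSum`), `rhsT` (`ite`) and the decided implication.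
[cite: AroraBarak2009, §1.3 (closure of polynomial time under composition and bounded loops)] -/
theorem stub_checkFP :
    ∀ χ : List Bool → Bool,
      CodeFP (pairE (rawE strE) (pairE unE strE)) natE (fun t => valT χ t.1 t.2.1 t.2.2) →
        CodeFP (pairE (pairE strE strE) strE) bitE (fun t => checkB χ t.1.1 t.1.2 t.2) := by
  intro χ hval
  -- the three fields and the parsed data
  let T : (List Bool × List Bool) × List Bool → List Bool := pairE (pairE strE strE) strE
  have hw : CodeFP T strE (fun t => t.1.2) := (fst _ _).snd'
  have hy : CodeFP T strE (fun t => t.2) := snd _ _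
  have hW : CodeFP T (rawE strE) (fun t => decNil t.1.2) := SumcheckMA.decNilC.comp hw
  have hs : CodeFP strE strE fstF := of_fn fstF fstF_mem_FP fun _ => rfl
  have hfx : CodeFP T strE (fun t => fstF t.1.1) := hs.comp (fst _ _).fst'
  have hBu : CodeFP T unE (fun t => (fstF t.1.1).length + 1) := unSucc.comp (strLength.comp hfx)
  have hxN : CodeFP T natE (fun t => (fstF t.1.1).length) := (natOfUn.comp (strLength.comp hfx) :)
  have hyU : CodeFP T unE (fun t => t.2.length) := strLength.comp hy
  have hyN : CodeFP T natE (fun t => t.2.length) := (natOfUn.comp hyU :)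
  have hr : CodeFP T natE (fun t => Nat.sqrt t.2.length) := natSqrt.comp hyN
  -- the hypothesis of the test: `y` is a square word of length `≤ |fstF x|`
  have hcond : CodeFP T bitE (fun t => decide (Nat.sqrt t.2.length * Nat.sqrt t.2.length = t.2.length) &&
      decide (t.2.length ≤ (fstF t.1.1).length)) :=
    (natEq.comp ((natMul.comp (hr.pair hr)).pair hyN)).and (natLe.comp (hyN.pair hxN))
  -- the left-hand side of the test
  have hlhs : CodeFP T natE (fun t => valT χ (decNil t.1.2) ((fstF t.1.1).length + 1) t.2) :=
    (hval.comp (hW.pair (hBu.pair hy)) :)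
  -- the side `k = √|y| - 1` of the minors, in unary, and the range `[0, k]` of the column indices
  have hk : CodeFP T natE (fun t => Nat.sqrt t.2.length - 1) := natSub.comp (hr.pair (const _ 1))
  have hkU : CodeFP T unE (fun t => Nat.sqrt t.2.length - 1) :=
    (unOfNatMin.comp (hyU.pair hk)).congr fun t =>
      min_eq_left ((Nat.sub_le _ _).trans (Nat.sqrt_le_self _))
  have hJ : CodeFP T (rawE natE) (fun t => List.range (Nat.sqrt t.2.length - 1 + 1)) :=
    urange.comp (unSucc.comp hkU)
  -- the Laplace term of column `j` (context `r.1 = t`, item `r.2 = j`)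
  let R : ((List Bool × List Bool) × List Bool) × ℕ → List Bool := pairE T natE
  have ry : CodeFP R strE (fun r => r.1.2) := (fst _ _).snd'
  have rj : CodeFP R natE (fun r => r.2) := snd _ _
  have rbit : CodeFP R bitE (fun r => r.1.2.getD r.2 false) := strGetDNat.comp (ry.pair rj)
  have rminor : CodeFP R strE (fun r => minorWord (Nat.sqrt r.1.2.length - 1) r.2 r.1.2) :=
    (minorWord_codeFP.comp (ry.pair ((hkU.comp (fst _ _)).pair rj)) :)
  have rval : CodeFP R natE (fun r => valT χ (decNil r.1.1.2) ((fstF r.1.1.1).length + 1)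
      (minorWord (Nat.sqrt r.1.2.length - 1) r.2 r.1.2)) :=
    (hval.comp ((hW.comp (fst _ _)).pair ((hBu.comp (fst _ _)).pair rminor)) :)
  have rterm : CodeFP R natE (fun r => if r.1.2.getD r.2 false then
      valT χ (decNil r.1.1.2) ((fstF r.1.1.1).length + 1) (minorWord (Nat.sqrt r.1.2.length - 1) r.2 r.1.2)
        else 0) :=
    (rbit.ite rval (const _ 0) :)
  have hlap : CodeFP T natE (fun t => laplaceSum (Nat.sqrt t.2.length - 1) t.2
      (valT χ (decNil t.1.2) ((fstF t.1.1).length + 1))) :=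
    (natSum.comp ((CodeFP.map rterm).comp ((CodeFP.id T).pair hJ))).congr fun t => rfl
  -- the right-hand side of the test
  have hrhs : CodeFP T natE (fun t => rhsT χ (decNil t.1.2) ((fstF t.1.1).length + 1) t.2) :=
    ((natEq.comp (hyN.pair (const _ 0))).ite (const _ 1) hlap).congr fun t => by
      simp only [rhsT, decide_eq_true_eq]
  -- the decided implication
  exact (hcond.not.or (natEq.comp (hlhs.pair hrhs))).congr fun t => not_and_or_eq_decide_imp _ _ _

end Summit.PneNP.PneNP.Theorems.PermCert
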